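import Mathlib
import Summits.Ventures.PercRepro2.K5K3Kernel
import Summits.Ventures.PercRepro2.K5HyperI

/-!
# THE CRUX KERNEL `K₃` WITH A HYPEREDGE ON `K₅`: THE KRONECKER NUMBERS
(blind cell PercRepro2, typer-1 g10; mine-1 §23.12 — the hyperedge base terms `N(K₅ + T(1))`,
`N(K₅ + T(2))` of the (TRI) kernel, the pieces of the §23.1 star identities for a non-hat unmarked vertex
of degree `3`)

`K₃` on `K₅` at the marks `(0, 1, 2, 3, 4)` is `10` positive − `10` negative products of the tables of
`K5K3Kernel.lean` (`K5K3Tables.K3_apply`); through the masks (`orOn`, bit tables) the positive / negative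
parts of a pattern are `posOn3 S₁ S₂ S₃` / `negOn3 S₁ S₂ S₃`, and the placement sums of `K5HyperI.lean`
give `N(K₅ + T(t))` as `sumT1 / sumT2`.  Certificates (`K5HyperCertK3T*.lean`):
`cert_K3T1_abc : CertLE (sumT1 negOn3 D) (sumT1 posOn3 D)` and `cert_K3T2_abc : CertLE (sumT2 negOn3 D)
(sumT2 posOn3 D)` for every triangle `T = {a, b, c}` (`60` products each, `≈ 30 s`).  The comparisons
`M-TRI` / `TvT-TRI` (`240` / `600` products) exceed the farm's memory cap in this encoding and are not
attempted.  Python twin `k5hyper_k3_typer.py`.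
-/

namespace Summit.Ventures.PercRepro2

namespace K5

/-- The positive products of `K₃` on the pattern `(S₁, S₂, S₃)` (marks `(0, 1, 2, 3, 4)`). -/
def posOn3 (S₁ S₂ S₃ : Fin 10 → Bool) : ℕ :=
  kron3 tPD S₁ * kron3 tQ S₂ * kron3 (t4p 4) S₃ + kron3 tQ S₁ * kron3 tPDoU S₂ * kron3 (t5p 4) S₃ +
    kron3 tPD S₁ * kron3 tQ S₂ * kron3 (t6m 4) S₃ +
    kron3 tPD S₁ * kron3 (t7p 4) S₂ * kron3 (t7m 0) S₃ + kron3 tPD S₁ * kron3 (t7m 4) S₂ * kron3 (t7p 0) S₃ +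
    kron3 tPDoU S₁ * kron3 (t7p 4) S₂ * kron3 (t7m 3) S₃ + kron3 tPDoU S₁ * kron3 (t7m 4) S₂ * kron3 (t7p 3) S₃ +
    kron3 tPD S₁ * kron3 (t7p 4) S₂ * kron3 t10p S₃ + kron3 tPD S₁ * kron3 (t7m 4) S₂ * kron3 t10m S₃ +
    kron3 tQ S₁ * kron3 (t12 4) S₂ * kron3 tPDoU S₃

/-- The negative products of `K₃` on the pattern `(S₁, S₂, S₃)`. -/
def negOn3 (S₁ S₂ S₃ : Fin 10 → Bool) : ℕ :=
  kron3 tPD S₁ * kron3 tQ S₂ * kron3 (t4m 4) S₃ + kron3 tQ S₁ * kron3 tPDoU S₂ * kron3 (t5m 4) S₃ +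
    kron3 tPD S₁ * kron3 tQ S₂ * kron3 (t6p 4) S₃ +
    kron3 tPD S₁ * kron3 (t7p 4) S₂ * kron3 (t7p 0) S₃ + kron3 tPD S₁ * kron3 (t7m 4) S₂ * kron3 (t7m 0) S₃ +
    kron3 tPDoU S₁ * kron3 (t7p 4) S₂ * kron3 (t7p 3) S₃ + kron3 tPDoU S₁ * kron3 (t7m 4) S₂ * kron3 (t7m 3) S₃ +
    kron3 tPD S₁ * kron3 (t7p 4) S₂ * kron3 t10m S₃ + kron3 tPD S₁ * kron3 (t7m 4) S₂ * kron3 t10p S₃ +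
    kron3 tPD S₁ * kron3 tQ S₂ * kron3 (t11 4) S₃

end K5

end Summit.Ventures.PercRepro2
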